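import Literature.NumberTheory.GaloisCohomology.Howard2004.KolyvaginSystemRescalingProofs
import HarnessLib

/-!
# Howard 2004, Def. 1.1.8 / §1.6: the unit relating two finite–singular slots is compatible along
# the transitions `T/I_nT → T/I_{n'}T` and the reductions `T^{(k+1)} → T^{(k)}`

Topic `NumberTheory/GaloisCohomology/Howard2004`; theorems only (no definition, no named fact, no
`sorry`).  Cell `pub/bsd-print-x9`, x9-p1 LEAD ruling 2026-08-28 «(n2)»: «`fs = u · φ^{fs}` with
units COMPATIBLE in `(k, n)`».  `FiniteSingularSlotUnitsProofs` produces, at ONE pair `(m, λ)`, a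
unit `u` with `fs₂ = ((u•) ⊗ 1) ∘ fs` on the finite classes; the transport
(`KolyvaginSystemRescalingProofs`) wants ONE scalar per prime, valid at every level `k` and every
`n ∋ ℓ`.  This file supplies the two transfers that reduce the choice to a single pair per prime:

* `sqSMul_singularQuotientMap_comm` — `H¹_s(g) ⊗ 1` commutes with `(r•) ⊗ 1` for an `R`-linear
  locally equivariant `g : T/I_mT → T/I_{m'}T`;
* **`fs_eq_sqSMul_transfer`** — if `H¹(g)` maps the finite classes of `T/I_mT` ONTO those of
  `T/I_{m'}T` and both slots are natural along `g`, the relation `fs₂ = ((u•) ⊗ 1) ∘ fs` at `(m, λ)`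
  transfers to `(m', λ)` with THE SAME `u` (e.g. `m = {λ} ⊆ m'`: the unit at `n ∋ ℓ` is the one at
  `{ℓ}`);
* `DVRSetting.fsQ_sqSMul_comm`, **`DVRSetting.fs_eq_sqSMul_transfer_red`** — the same along the
  level reductions `T^{(k+1)}/I_n → T^{(k)}/I_n` (`rqLocH1`, `fsQ`; naturality = `fs_natural` /
  `fsQ_spec` of `SatisfiesH`), for a scalar of `R` read in `R_{k+1}` and `R_k`: valid at level
  `k+1` ⇒ valid at level `k`.

Not here: the surjectivity of `H¹(g)` / `rqLocH1` on the finite classes (from the evaluation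
isomorphisms `H¹_ur ≅ T/I` of Prop. 1.1.7, (n1)) and the final choice of one `u_ℓ ∈ Rˣ` for all
levels (a level large enough that `T^{(k)}/I_ℓ` is stationary, or a nested-coset argument in the
DVR).  BSD is not proved by any of this.

References: B. Howard, *The Heegner point Kolyvagin system*, Compositio Math. 140 (2004), Def.
1.1.3, 1.1.8, §1.6 (arXiv:1202.6340 p. 5, p. 11 L45–50).
-/

set_option autoImplicit false

noncomputable section

open Function NumberField IsDedekindDomain Field
open scoped NumberField ContRepresentation Classical TensorProduct

namespace Literature.NumberTheory.GaloisCohomology.Howard2004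

open Literature.NumberTheory.GaloisRepresentations
open Literature.NumberTheory.GaloisRepresentations.DiscreteGaloisModule
open Literature.NumberTheory.GaloisRepresentations.galoisCohomology

/-- Tensor bookkeeping: `(F ⊗ 1) ∘ (σ_A ⊗ 1) = (σ_B ⊗ 1) ∘ (F ⊗ 1)` when `F ∘ σ_A = σ_B ∘ F`. [folklore] -/
private theorem map_map_of_comp_eq {A B G : Type} [AddCommGroup A] [AddCommGroup B]
    {_ : AddCommMonoid G} {_ : Module ℤ G} (F : A →+ B) (σA : A →+ A) (σB : B →+ B)
    (h : F.comp σA = σB.comp F) (x : A ⊗[ℤ] G) :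
    TensorProduct.map F.toIntLinearMap LinearMap.id
        (TensorProduct.map σA.toIntLinearMap LinearMap.id x) =
      TensorProduct.map σB.toIntLinearMap LinearMap.id
        (TensorProduct.map F.toIntLinearMap LinearMap.id x) := by
  induction x using TensorProduct.induction_on with
  | zero => simp only [map_zero]
  | add x y hx hy => simp only [map_add, hx, hy]
  | tmul a g =>
    simp only [TensorProduct.map_tmul, AddMonoidHom.coe_toIntLinearMap, LinearMap.id_coe, id_eq]
    rw [← AddMonoidHom.comp_apply, h, AddMonoidHom.comp_apply]

namespace LevelData

variable {K : Type} [Field K] [NumberField K] {M : Type} [AddCommGroup M] [TopologicalSpace M]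
  [DiscreteTopology M] {R : Type} [CommRing R] [Module R M]
  {p : ℕ} [Fact p.Prime] {ρ : DiscreteGaloisModule K M} {t : SelmerTriple p ρ}
  {N : Finset (HeightOneSpectrum (𝓞 K)) → Type} [∀ n, AddCommGroup (N n)]
  [∀ n, TopologicalSpace (N n)] [∀ n, DiscreteTopology (N n)] [∀ n, Module R (N n)]

omit [Fact p.Prime] in
/-- `H¹(K_λ, g)` commutes with the scalars for an `R`-linear locally equivariant `g` between two
presentations. [cite: Howard2004HeegnerKolyvagin, Def. 1.1.3 (arXiv p. 5, L93–99)] -/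
theorem localH1Map_scalarMapH1 (D : LevelData R ρ t N) (hρ : ρ.IsScalarLinear R)
    {m m' : Finset (HeightOneSpectrum (𝓞 K))} (v : HeightOneSpectrum (𝓞 K)) (g : N m →ₗ[R] N m')
    (hg : ∀ (σ : absoluteGaloisGroup (v.adicCompletion K)) (x : N m),
      g.toAddMonoidHom (GaloisRep.toLocal v (D.ρq m) σ x) =
        GaloisRep.toLocal v (D.ρq m') σ (g.toAddMonoidHom x))
    (r : R) (x : galoisCohomology (GaloisRep.toLocal v (D.ρq m)) 1) :
    localH1Map (D.ρq m) (D.ρq m') v g.toAddMonoidHom hg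
        (scalarMapH1 (GaloisRep.toLocal v (D.ρq m)) ((D.isScalarLinear hρ m).restrictField _) r x) =
      scalarMapH1 (GaloisRep.toLocal v (D.ρq m')) ((D.isScalarLinear hρ m').restrictField _) r
        (localH1Map (D.ρq m) (D.ρq m') v g.toAddMonoidHom hg x) :=
  map_scalarMapH1 _ _ (localIntertwining (D.ρq m) (D.ρq m') v g.toAddMonoidHom hg)
    (fun r y => g.map_smul r y) r x

omit [Fact p.Prime] in
/-- **`(H¹_s(g) ⊗ 1) ∘ ((r•) ⊗ 1) = ((r•) ⊗ 1) ∘ (H¹_s(g) ⊗ 1)`** on `H¹_s ⊗ G_ℓ`, for an `R`-linear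
locally equivariant `g : T/I_mT → T/I_{m'}T`. [cite: Howard2004HeegnerKolyvagin, Def. 1.1.3 and Def. 1.1.8 (arXiv p. 5)] -/
theorem sqSMul_singularQuotientMap_comm (D : LevelData R ρ t N) (hρ : ρ.IsScalarLinear R)
    {m m' : Finset (HeightOneSpectrum (𝓞 K))} (v : HeightOneSpectrum (𝓞 K)) (g : N m →ₗ[R] N m')
    (hg : ∀ (σ : absoluteGaloisGroup (v.adicCompletion K)) (x : N m),
      g.toAddMonoidHom (GaloisRep.toLocal v (D.ρq m) σ x) =
        GaloisRep.toLocal v (D.ρq m') σ (g.toAddMonoidHom x))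
    (r : R) (y : SingularQuotient (GaloisRep.toLocal v (D.ρq m)) ⊗[ℤ] Gell v) :
    TensorProduct.map (singularQuotientMap (D.ρq m) (D.ρq m') v g.toAddMonoidHom hg).toIntLinearMap
        LinearMap.id (D.sqSMul hρ m v r y) =
      D.sqSMul hρ m' v r (TensorProduct.map
        (singularQuotientMap (D.ρq m) (D.ρq m') v g.toAddMonoidHom hg).toIntLinearMap LinearMap.id y) := by
  rw [sqSMul_def, sqSMul_def]
  refine map_map_of_comp_eq _ _ _ (AddMonoidHom.ext fun q => ?_) y
  obtain ⟨c, rfl⟩ := QuotientAddGroup.mk'_surjective (unramifiedSubgroup (GaloisRep.toLocal v (D.ρq m)) 1) q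
  -- both sides are `loc^s` of a class of `H¹(K_λ, T/I_{m'}T)`; compare those classes
  exact congrArg (singularMap (GaloisRep.toLocal v (D.ρq m')))
    (D.localH1Map_scalarMapH1 hρ v g hg r c)

omit [Fact p.Prime] in
/-- **Transfer of the unit along a transition.**  Let `g : T/I_mT → T/I_{m'}T` be `R`-linear and
locally equivariant at `λ`, with `H¹(K_λ, g)` mapping the finite classes of `T/I_mT` ONTO those of
`T/I_{m'}T`; let the slot `fs` of `D` be natural along `g` (`FsNaturalAt m m' λ`) and let a second
pair of slots `fs₂` (at `m`), `fs₂'` (at `m'`) be natural along `g` on the finite classes.  If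
`fs₂ = ((u•) ⊗ 1) ∘ fs` on the finite classes at `(m, λ)`, then `fs₂' = ((u•) ⊗ 1) ∘ fs` on the
finite classes at `(m', λ)` — the SAME scalar (e.g. `m = {λ} ⊆ m'`: «units compatible in `n`»).
[cite: Howard2004HeegnerKolyvagin, Def. 1.1.3 and Def. 1.1.8 (arXiv p. 5, L93–99 and L115–131)] -/
theorem fs_eq_sqSMul_transfer (D : LevelData R ρ t N) (hρ : ρ.IsScalarLinear R)
    {m m' : Finset (HeightOneSpectrum (𝓞 K))} {v : HeightOneSpectrum (𝓞 K)} (g : N m →ₗ[R] N m')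
    (hg : ∀ (σ : absoluteGaloisGroup (v.adicCompletion K)) (x : N m),
      g.toAddMonoidHom (GaloisRep.toLocal v (D.ρq m) σ x) =
        GaloisRep.toLocal v (D.ρq m') σ (g.toAddMonoidHom x))
    (hsurj : ∀ c' ∈ unramifiedSubgroup (GaloisRep.toLocal v (D.ρq m')) 1,
      ∃ c ∈ unramifiedSubgroup (GaloisRep.toLocal v (D.ρq m)) 1,
        localH1Map (D.ρq m) (D.ρq m') v g.toAddMonoidHom hg c = c')
    (h1 : D.FsNaturalAt m m' v)
    (fs₂ : galoisCohomology ((D.ρq m).toLocal (Sum.inr v)) 1 →+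
      SingularQuotient (GaloisRep.toLocal v (D.ρq m)) ⊗[ℤ] Gell v)
    (fs₂' : galoisCohomology ((D.ρq m').toLocal (Sum.inr v)) 1 →+
      SingularQuotient (GaloisRep.toLocal v (D.ρq m')) ⊗[ℤ] Gell v)
    (h2 : ∀ c ∈ unramifiedSubgroup (GaloisRep.toLocal v (D.ρq m)) 1,
      fs₂' (localH1Map (D.ρq m) (D.ρq m') v g.toAddMonoidHom hg c) =
        TensorProduct.map (singularQuotientMap (D.ρq m) (D.ρq m') v g.toAddMonoidHom hg).toIntLinearMap
          LinearMap.id (fs₂ c))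
    (u : R) (hrel : ∀ c ∈ unramifiedSubgroup (GaloisRep.toLocal v (D.ρq m)) 1,
      fs₂ c = D.sqSMul hρ m v u (D.fs m v c)) :
    ∀ c' ∈ unramifiedSubgroup (GaloisRep.toLocal v (D.ρq m')) 1,
      fs₂' c' = D.sqSMul hρ m' v u (D.fs m' v c') := by
  intro c' hc'
  obtain ⟨c, hc, rfl⟩ := hsurj c' hc'
  rw [h2 c hc, hrel c hc, D.sqSMul_singularQuotientMap_comm hρ v g hg, ← h1 g hg c hc]

end LevelData

/-! ## Along the level reductions of a `DVRSetting` -/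

namespace DVRSetting

variable {p : ℕ} [Fact p.Prime] {K : Type} [Field K] [NumberField K]
  {R : Type} [CommRing R] [IsDomain R] [IsDiscreteValuationRing R] [Algebra ℤ_[p] R]
  {N : ℕ → Type} [∀ k, AddCommGroup (N k)] [∀ k, TopologicalSpace (N k)]
  [∀ k, DiscreteTopology (N k)] [∀ k, Module R (N k)]
  {Rk : ℕ → Type} [∀ k, CommRing (Rk k)] [∀ k, IsLocalRing (Rk k)] [∀ k, TopologicalSpace (Rk k)]
  [∀ k, DiscreteTopology (Rk k)] [∀ k, Algebra ℤ_[p] (Rk k)] [∀ k, Algebra R (Rk k)]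
  [∀ k, Module (Rk k) (N k)] [∀ k, IsScalarTower R (Rk k) (N k)]
  {Nbar : Type} [AddCommGroup Nbar] [TopologicalSpace Nbar] [DiscreteTopology Nbar]
  [∀ k, Module (Rk k) Nbar]
  {Nq : ℕ → Finset (HeightOneSpectrum (𝓞 K)) → Type} [∀ k n, AddCommGroup (Nq k n)]
  [∀ k n, TopologicalSpace (Nq k n)] [∀ k n, DiscreteTopology (Nq k n)]
  [∀ k n, Module (Rk k) (Nq k n)] [∀ k n, Module R (Nq k n)]
  [∀ k n, IsScalarTower R (Rk k) (Nq k n)]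

/-- The local reduction `H¹(K_λ, T^{(k+1)}/I_n) → H¹(K_λ, T^{(k)}/I_n)` commutes with the scalars of
`R` (read through `R → R_{k+1}`, `R → R_k`). [cite: Howard2004HeegnerKolyvagin, §1.6 (arXiv p. 11, L45–50)] -/
theorem rqLocH1_scalarMapH1 (S : DVRSetting p K R N Rk Nbar Nq)
    (hlin : ∀ k, (S.T.ρ k).IsScalarLinear (Rk k)) (k : ℕ) (n : Finset (HeightOneSpectrum (𝓞 K)))
    (v : HeightOneSpectrum (𝓞 K)) (r : R)
    (x : galoisCohomology (GaloisRep.toLocal v ((S.LD (k + 1)).ρq n)) 1) :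
    S.rqLocH1 k n v (scalarMapH1 (GaloisRep.toLocal v ((S.LD (k + 1)).ρq n))
        (((S.LD (k + 1)).isScalarLinear (hlin (k + 1)) n).restrictField _)
        (algebraMap R (Rk (k + 1)) r) x) =
      scalarMapH1 (GaloisRep.toLocal v ((S.LD k).ρq n))
        (((S.LD k).isScalarLinear (hlin k) n).restrictField _) (algebraMap R (Rk k) r)
        (S.rqLocH1 k n v x) := by
  rw [scalarMapH1_algebraMap, scalarMapH1_algebraMap]
  exact cohomologyMap_scalarMapH1 (ρ := GaloisRep.toLocal v ((S.LD (k + 1)).ρq n))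
    (ρ' := GaloisRep.toLocal v ((S.LD k).ρq n)) _ _ (S.rq k n)
    (fun σ y => S.rq_equivariant k n _ y) r x

/-- **`(fsQ ⊗ 1) ∘ ((u•)_{k+1} ⊗ 1) = ((u•)_k ⊗ 1) ∘ (fsQ ⊗ 1)`**: the map of singular quotients along
the reduction (pinned by `fsQ_spec`) commutes with a scalar of `R`.
[cite: Howard2004HeegnerKolyvagin, §1.6 and display (ks relations) (arXiv p. 6, p. 11)] -/
theorem fsQ_sqSMul_comm (S : DVRSetting p K R N Rk Nbar Nq)
    (hlin : ∀ k, (S.T.ρ k).IsScalarLinear (Rk k)) (k : ℕ) (n : Finset (HeightOneSpectrum (𝓞 K)))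
    (v : HeightOneSpectrum (𝓞 K))
    (hQ : ∀ x : galoisCohomology (GaloisRep.toLocal v ((S.LD (k + 1)).ρq n)) 1,
      S.fsQ k n v (singularMap _ x) = singularMap _ (S.rqLocH1 k n v x))
    (r : R) (y : SingularQuotient (GaloisRep.toLocal v ((S.LD (k + 1)).ρq n)) ⊗[ℤ] Gell v) :
    TensorProduct.map (S.fsQ k n v).toIntLinearMap LinearMap.id
        ((S.LD (k + 1)).sqSMul (hlin (k + 1)) n v (algebraMap R (Rk (k + 1)) r) y) =
      (S.LD k).sqSMul (hlin k) n v (algebraMap R (Rk k) r)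
        (TensorProduct.map (S.fsQ k n v).toIntLinearMap LinearMap.id y) := by
  rw [LevelData.sqSMul_def, LevelData.sqSMul_def]
  refine map_map_of_comp_eq _ _ _ (AddMonoidHom.ext fun q => ?_) y
  obtain ⟨c, rfl⟩ :=
    QuotientAddGroup.mk'_surjective (unramifiedSubgroup (GaloisRep.toLocal v ((S.LD (k + 1)).ρq n)) 1) q
  -- `fsQ (loc^s (H¹(u•) c)) = loc^s (rqLocH1 (H¹(u•) c)) = loc^s (H¹(u•) (rqLocH1 c)) = (u•) (fsQ (loc^s c))`
  change S.fsQ k n v (singularMap _ (localH1Map _ _ v _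
      (smul_id_toLocal ((S.LD (k + 1)).isScalarLinear (hlin (k + 1)) n) v (algebraMap R (Rk (k + 1)) r))
      c)) =
    singularQuotientMap _ _ v _
      (smul_id_toLocal ((S.LD k).isScalarLinear (hlin k) n) v (algebraMap R (Rk k) r))
      (S.fsQ k n v (singularMap _ c))
  rw [hQ, hQ, singularQuotientMap_singularMap]
  exact congrArg (singularMap (GaloisRep.toLocal v ((S.LD k).ρq n))) (S.rqLocH1_scalarMapH1 hlin k n v r c)

/-- **Transfer of the unit along a level reduction.**  With `fs` natural along the reduction
(`SatisfiesH.fs_natural` shape, hypothesis `hS`) and `fsQ` THE map of singular quotients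
(`fsQ_spec`, hypothesis `hQ`), a second family of slots `fs₂` natural along the reduction on the
finite classes (`h2`), and `rqLocH1` mapping the finite classes of level `k+1` ONTO those of level
`k`: if `fs₂ = ((u•) ⊗ 1) ∘ fs` on the finite classes at level `k+1` (scalar `u ∈ R` read in
`R_{k+1}`), then the same holds at level `k` with `u` read in `R_k` («units compatible in `k`»).
[cite: Howard2004HeegnerKolyvagin, §1.6 and Def. 1.1.8 (arXiv p. 11 L45–50, p. 5 L126–131)] -/
theorem fs_eq_sqSMul_transfer_red (S : DVRSetting p K R N Rk Nbar Nq)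
    (hlin : ∀ k, (S.T.ρ k).IsScalarLinear (Rk k)) (k : ℕ) (n : Finset (HeightOneSpectrum (𝓞 K)))
    (v : HeightOneSpectrum (𝓞 K))
    (hS : ∀ x : galoisCohomology (GaloisRep.toLocal v ((S.LD (k + 1)).ρq n)) 1,
      (S.LD k).fs n v (S.rqLocH1 k n v x) =
        TensorProduct.map (S.fsQ k n v).toIntLinearMap LinearMap.id ((S.LD (k + 1)).fs n v x))
    (hQ : ∀ x : galoisCohomology (GaloisRep.toLocal v ((S.LD (k + 1)).ρq n)) 1,
      S.fsQ k n v (singularMap _ x) = singularMap _ (S.rqLocH1 k n v x))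
    (hsurj : ∀ c' ∈ unramifiedSubgroup (GaloisRep.toLocal v ((S.LD k).ρq n)) 1,
      ∃ c ∈ unramifiedSubgroup (GaloisRep.toLocal v ((S.LD (k + 1)).ρq n)) 1, S.rqLocH1 k n v c = c')
    (fs₂ : ∀ k, galoisCohomology (((S.LD k).ρq n).toLocal (Sum.inr v)) 1 →+
      SingularQuotient (GaloisRep.toLocal v ((S.LD k).ρq n)) ⊗[ℤ] Gell v)
    (h2 : ∀ c ∈ unramifiedSubgroup (GaloisRep.toLocal v ((S.LD (k + 1)).ρq n)) 1,
      fs₂ k (S.rqLocH1 k n v c) =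
        TensorProduct.map (S.fsQ k n v).toIntLinearMap LinearMap.id (fs₂ (k + 1) c))
    (u : R)
    (hrel : ∀ c ∈ unramifiedSubgroup (GaloisRep.toLocal v ((S.LD (k + 1)).ρq n)) 1,
      fs₂ (k + 1) c = (S.LD (k + 1)).sqSMul (hlin (k + 1)) n v (algebraMap R (Rk (k + 1)) u)
        ((S.LD (k + 1)).fs n v c)) :
    ∀ c' ∈ unramifiedSubgroup (GaloisRep.toLocal v ((S.LD k).ρq n)) 1,
      fs₂ k c' = (S.LD k).sqSMul (hlin k) n v (algebraMap R (Rk k) u) ((S.LD k).fs n v c') := by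
  intro c' hc'
  obtain ⟨c, hc, rfl⟩ := hsurj c' hc'
  rw [h2 c hc, hrel c hc, S.fsQ_sqSMul_comm hlin k n v hQ, ← hS]

/-- **Transfer of the unit UP a level reduction, where the reduction is injective on `H¹_s ⊗ G_ℓ`.**
Same data as `fs_eq_sqSMul_transfer_red`; if moreover `fsQ ⊗ 1` is injective (e.g. the reduction
`T^{(k+1)}/I_n → T^{(k)}/I_n` is bijective — the case `n = {ℓ}`, `e_k ≥ v(ℓ + 1)`, where
`T^{(k)}/I_ℓ T^{(k)}` is stationary) and `rqLocH1` carries finite classes to finite classes, then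
«valid at level `k` with `algebraMap_k u`» ⇒ «valid at level `k+1` with `algebraMap_{k+1} u`»:
apply `fsQ ⊗ 1` to both sides and use the level-`k` relation.  With `_red` this pins ONE `u ∈ R`
for all levels from its validity at a single level.
[cite: Howard2004HeegnerKolyvagin, §1.6 and Def. 1.1.8 (arXiv p. 11 L45–50, p. 5 L126–131)] -/
theorem fs_eq_sqSMul_transfer_red_up (S : DVRSetting p K R N Rk Nbar Nq)
    (hlin : ∀ k, (S.T.ρ k).IsScalarLinear (Rk k)) (k : ℕ) (n : Finset (HeightOneSpectrum (𝓞 K)))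
    (v : HeightOneSpectrum (𝓞 K))
    (hS : ∀ x : galoisCohomology (GaloisRep.toLocal v ((S.LD (k + 1)).ρq n)) 1,
      (S.LD k).fs n v (S.rqLocH1 k n v x) =
        TensorProduct.map (S.fsQ k n v).toIntLinearMap LinearMap.id ((S.LD (k + 1)).fs n v x))
    (hQ : ∀ x : galoisCohomology (GaloisRep.toLocal v ((S.LD (k + 1)).ρq n)) 1,
      S.fsQ k n v (singularMap _ x) = singularMap _ (S.rqLocH1 k n v x))
    (hinj : Function.Injective (TensorProduct.map (S.fsQ k n v).toIntLinearMap
      (LinearMap.id : Gell v →ₗ[ℤ] Gell v)))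
    (hur : ∀ c ∈ unramifiedSubgroup (GaloisRep.toLocal v ((S.LD (k + 1)).ρq n)) 1,
      S.rqLocH1 k n v c ∈ unramifiedSubgroup (GaloisRep.toLocal v ((S.LD k).ρq n)) 1)
    (fs₂ : ∀ k, galoisCohomology (((S.LD k).ρq n).toLocal (Sum.inr v)) 1 →+
      SingularQuotient (GaloisRep.toLocal v ((S.LD k).ρq n)) ⊗[ℤ] Gell v)
    (h2 : ∀ c ∈ unramifiedSubgroup (GaloisRep.toLocal v ((S.LD (k + 1)).ρq n)) 1,
      fs₂ k (S.rqLocH1 k n v c) =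
        TensorProduct.map (S.fsQ k n v).toIntLinearMap LinearMap.id (fs₂ (k + 1) c))
    (u : R)
    (hrel : ∀ c' ∈ unramifiedSubgroup (GaloisRep.toLocal v ((S.LD k).ρq n)) 1,
      fs₂ k c' = (S.LD k).sqSMul (hlin k) n v (algebraMap R (Rk k) u) ((S.LD k).fs n v c')) :
    ∀ c ∈ unramifiedSubgroup (GaloisRep.toLocal v ((S.LD (k + 1)).ρq n)) 1,
      fs₂ (k + 1) c = (S.LD (k + 1)).sqSMul (hlin (k + 1)) n v (algebraMap R (Rk (k + 1)) u)
        ((S.LD (k + 1)).fs n v c) := by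
  intro c hc
  apply hinj
  change TensorProduct.map (S.fsQ k n v).toIntLinearMap LinearMap.id (fs₂ (k + 1) c) =
    TensorProduct.map (S.fsQ k n v).toIntLinearMap LinearMap.id
      ((S.LD (k + 1)).sqSMul (hlin (k + 1)) n v (algebraMap R (Rk (k + 1)) u) ((S.LD (k + 1)).fs n v c))
  rw [← h2 c hc, hrel _ (hur c hc), S.fsQ_sqSMul_comm hlin k n v hQ, ← hS]

end DVRSetting

end Literature.NumberTheory.GaloisCohomology.Howard2004

end
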